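import Summits.RiemannHypothesis.RiemannHypothesis.Theorems.TiltedLandingLaw421R3RateChildCountA

/-! # RATE CHILD COUNT (D) — the CHILD COUNT at an `m`-FOLD pair (leaf L1 of R1a′; lens-2 g4, stmt-RiemannHypothesis-33346)

`G = q^m·h` (`q = pairQ a b`, `m ≥ 1`, `h` zero-free on the closed Jensen disc): `G′ = q^(m−1)·H` with the ENTIRE
`H := 2m(z − a)·h + q·h′`; on the Jensen circle `q = 2b cos θ·(z − a)`, so `H = 2m(z − a)·h·g` with `g = 1 + (b/m) cos θ·(h′/h)` — the `m = 1`
computation of module (A) with the field `h′/h` scaled by `1/m`.  ★★ `childCountM`: the number of zeros of `H` in the closed disc is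
`1 + [1 + (b/m)·Re (h′/h)(a+b) < 0] + [1 − (b/m)·Re (h′/h)(a−b) < 0]`.  (Module (A)'s `childCount` is the case `m = 1`, `H = G′`; this file is
its verbatim transform: `K := h′/(m·h)`.)  Imports = module (A)'s; namespace `RhW08.ChildCount`; 0 `sorry`.
Nothing here bears on the truth of RH; RH is not proved; 33346/33347 OPEN; checked ≠ proved. -/

noncomputable section

open Complex Metric Set
open scoped Real ComplexConjugate
open Literature.Topology.PlaneTopology
open Literature.Analysis.Complex

namespace RhW08.ChildCount

open RhW08.IsolatedTilt (pairQ)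

set_option maxHeartbeats 1600000 in
/-- ★★ (K) **CHILD COUNT ON THE JENSEN CIRCLE, `m`-FOLD PAIR.** `H = 2m(z − a)·h + q·h′` on `‖z − a‖ < ρ` (`q = pairQ a b`, `0 < b < ρ`,
`m ≥ 1`; for `G = q^m·h` one has `G′ = q^(m−1)·H`), `h` holomorphic there and zero-free on `‖z − a‖ ≤ b`, Jensen sign `Im z · Im (h′/h)(z) ≤ 0`
and `h′/h` real at real points of the circle `‖z − a‖ = b`, and `H` zero-free on that circle.  Then the number of zeros of `H` in the closed
Jensen disc, counted with multiplicity, is `1 + [1 + (b/m)·Re (h′/h)(a + b) < 0] + [1 − (b/m)·Re (h′/h)(a − b) < 0]`. -/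
theorem childCountM {H h : ℂ → ℂ} {a b ρ : ℝ} {m : ℕ} (hm : 0 < m) (hb : 0 < b) (hbρ : b < ρ)
    (hh : DifferentiableOn ℂ h (ball (a : ℂ) ρ))
    (hH : ∀ z ∈ ball (a : ℂ) ρ, H z = 2 * (m : ℂ) * (z - a) * h z + pairQ a b z * deriv h z)
    (hh0 : ∀ z ∈ closedBall (a : ℂ) b, h z ≠ 0)
    (hsign : ∀ z : ℂ, ‖z - a‖ = b → z.im * (deriv h z / h z).im ≤ 0)
    (hKreal : ∀ x : ℝ, ‖(x : ℂ) - a‖ = b → (deriv h x / h x).im = 0)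
    (hcirc : ∀ z : ℂ, ‖z - a‖ = b → H z ≠ 0) :
    ∑ᶠ u, MeromorphicOn.divisor H (closedBall (a : ℂ) b) u =
      1 + (if 1 + b * (deriv h ((a : ℂ) + b) / ((m : ℂ) * h ((a : ℂ) + b))).re < 0 then 1 else 0)
        + (if 1 - b * (deriv h ((a : ℂ) - b) / ((m : ℂ) * h ((a : ℂ) - b))).re < 0 then 1 else 0) := by
  have hm0 : (m : ℂ) ≠ 0 := Nat.cast_ne_zero.2 hm.ne'
  have hmR : (0 : ℝ) < m := Nat.cast_pos.2 hm
  set γ : ℝ → ℂ := circleLoop (a : ℂ) b with hγ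
  set K : ℂ → ℂ := fun z => deriv h z / ((m : ℂ) * h z) with hK
  set F : ℂ → ℂ := fun z => 2 * (z - a) + pairQ a b z * K z with hF
  set g : ℝ → ℂ := fun t => 1 + ((b * Real.cos (2 * π * t) : ℝ) : ℂ) * K (γ t) with hg
  -- geometry of the Jensen circle
  have hγa : ∀ t : ℝ, γ t - a = b * exp (((2 * π * t : ℝ)) * I) := by
    intro t; rw [hγ, circleLoop_apply]; push_cast; ring
  have hγe : ∀ t : ℝ, γ t = (a : ℂ) + b * exp (((2 * π * t : ℝ)) * I) := fun t => by rw [← hγa t]; ring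
  have hγnorm : ∀ t : ℝ, ‖γ t - a‖ = b := by intro t; rw [hγ, norm_circleLoop_sub_center, abs_of_pos hb]
  have hγball : ∀ t : ℝ, γ t ∈ ball (a : ℂ) ρ := fun t => by rw [mem_ball, dist_eq_norm, hγnorm]; exact hbρ
  have hγcl : ∀ t : ℝ, γ t ∈ closedBall (a : ℂ) b := fun t => by rw [mem_closedBall, dist_eq_norm, hγnorm]
  have hγim : ∀ t : ℝ, (γ t).im = b * Real.sin (2 * π * t) := by
    intro t
    have := congrArg Complex.im (hγa t)
    rw [sub_im, ofReal_im, sub_zero, im_ofReal_mul, exp_ofReal_mul_I_im] at this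
    exact this
  have h01γ : γ 0 = γ 1 := by rw [hγ]; exact circleLoop_zero_eq _ _
  have hγ0 : γ 0 = (((a + b : ℝ)) : ℂ) := by rw [hγe]; push_cast; simp
  have hγhalf : γ (1 / 2) = (((a - b : ℝ)) : ℂ) := by
    rw [hγe, show (((2 * π * (1 / 2 : ℝ) : ℝ)) : ℂ) * I = π * I by push_cast; ring, exp_pi_mul_I]; push_cast; ring
  -- calculus: `H = 2m(z − a)h + q h′` on the disc, `= m·h·F` on the circle, `F = 2(z − a)·g` on the circle
  have hGF : ∀ t : ℝ, H (γ t) = (m : ℂ) * h (γ t) * F (γ t) := by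
    intro t
    have hz := hh0 _ (hγcl t)
    rw [hH _ (hγball t), hF, hK]
    field_simp
  have hFg : ∀ t : ℝ, F (γ t) = 2 * (γ t - a) * g t := by
    intro t
    have hq : pairQ a b (γ t) = 2 * ((b * Real.cos (2 * π * t) : ℝ) : ℂ) * (b * exp ((2 * π * t : ℝ) * I)) := by
      rw [hγe t]; exact pairQ_circle a b (2 * π * t)
    simp only [hF, hg]
    rw [hq, hγa t]
    ring
  -- regularity
  have hh'd : DifferentiableOn ℂ (deriv h) (ball (a : ℂ) ρ) := (hh.analyticOnNhd isOpen_ball).deriv.differentiableOn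
  have hG'd : DifferentiableOn ℂ H (ball (a : ℂ) ρ) := by
    have hq : Differentiable ℂ (pairQ a b) := by unfold pairQ; fun_prop
    have h1 : DifferentiableOn ℂ (fun z => 2 * (m : ℂ) * (z - a) * h z + pairQ a b z * deriv h z) (ball (a : ℂ) ρ) :=
      DifferentiableOn.add (DifferentiableOn.mul (DifferentiableOn.mul (differentiableOn_const (2 * (m : ℂ)))
        (differentiableOn_id.sub (differentiableOn_const (a : ℂ)))) hh) (hq.differentiableOn.mul hh'd)
    exact h1.congr fun z hz => hH z hz
  have hmh0 : ∀ z ∈ closedBall (a : ℂ) b, (m : ℂ) * h z ≠ 0 := fun z hz => mul_ne_zero hm0 (hh0 z hz)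
  have hKc : ContinuousOn K (closedBall (a : ℂ) b) :=
    (hh'd.continuousOn.mono (closedBall_subset_ball hbρ)).div
      (continuousOn_const.mul (hh.continuousOn.mono (closedBall_subset_ball hbρ))) hmh0
  have hqc : Continuous (pairQ a b) := by unfold pairQ; fun_prop
  have hFc : ContinuousOn F (closedBall (a : ℂ) b) :=
    ((continuous_const.mul (continuous_id.sub continuous_const)).continuousOn).add (hqc.continuousOn.mul hKc)
  have hγc : Continuous γ := by rw [hγ]; exact continuous_circleLoop _ _
  have hcosc : Continuous fun t : ℝ => (((b * Real.cos (2 * π * t) : ℝ)) : ℂ) := by fun_prop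
  have hgc : ContinuousOn g (Icc 0 1) :=
    (continuousOn_const.add (hcosc.continuousOn.mul (hKc.comp hγc.continuousOn fun t _ => hγcl t)))
  -- non-vanishing on the circle
  have hF0 : ∀ t : ℝ, F (γ t) ≠ 0 := by
    intro t h0
    have := hcirc (γ t) (hγnorm t)
    rw [hGF t, h0, mul_zero] at this
    exact this rfl
  have hγa0 : ∀ t : ℝ, 2 * (γ t - a) ≠ 0 := by
    intro t h0
    have h1 : γ t - a = 0 := by
      rcases mul_eq_zero.1 h0 with h | h
      · norm_num at h
      · exact h
    have := hγnorm t
    rw [h1, norm_zero] at this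
    exact hb.ne' this.symm |>.elim
  have hg0 : ∀ t : ℝ, g t ≠ 0 := by
    intro t h0
    have := hF0 t
    rw [hFg t, h0, mul_zero] at this
    exact this rfl
  -- the loops
  have Lh : IsNonvanishingLoop (fun t => h (γ t)) :=
    ⟨hh.continuousOn.comp hγc.continuousOn fun t _ => hγball t, fun t _ => hh0 _ (hγcl t), by simp only [h01γ]⟩
  have Lmh : IsNonvanishingLoop (fun t => (m : ℂ) * h (γ t)) :=
    ⟨continuousOn_const.mul Lh.1, fun t ht => mul_ne_zero hm0 (Lh.2 t ht), by simp only [h01γ]⟩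
  have LF : IsNonvanishingLoop (fun t => F (γ t)) :=
    ⟨hFc.comp hγc.continuousOn fun t _ => hγcl t, fun t _ => hF0 t, by simp only [h01γ]⟩
  have L2 : IsNonvanishingLoop (fun t => 2 * (γ t - a)) :=
    ⟨(continuous_const.mul (hγc.sub continuous_const)).continuousOn, fun t _ => hγa0 t, by simp only [h01γ]⟩
  have g01 : g 0 = g 1 := by
    simp only [hg]; rw [h01γ, mul_zero, mul_one, Real.cos_zero, Real.cos_two_pi]
  have Lg : IsNonvanishingLoop g := ⟨hgc, fun t _ => hg0 t, g01⟩
  -- winding numbers: `G′∘γ`, `h∘γ`, `2(γ − a)`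
  have W0 := Rouche.wind_circleLoop_eq_finsum_divisor H hb hbρ hG'd fun u hu => hcirc u hu
  have Wh : wind (fun t => h (γ t)) = 0 := by
    have hsph : ∀ u : ℂ, ‖u - a‖ = b → h u ≠ 0 := fun u hu => hh0 u (by rw [mem_closedBall, dist_eq_norm, hu])
    have := Rouche.wind_circleLoop_eq_finsum_divisor h hb hbρ hh hsph
    rw [this]
    apply finsum_eq_zero_of_forall_eq_zero
    intro u
    by_contra hne
    obtain ⟨hu, h0⟩ := (Rouche.divisor_ne_zero_iff h hb hbρ hh hsph u).1 hne
    exact hh0 u hu h0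
  have W2 : wind (fun t => 2 * (γ t - a)) = 1 := by
    have e : wind (fun t => (fun _ : ℝ => (2 : ℂ)) t * (fun t => γ t - (a : ℂ)) t) =
        wind (fun _ : ℝ => (2 : ℂ)) + wind (fun t => γ t - (a : ℂ)) :=
      wind_mul (IsNonvanishingLoop.const two_ne_zero) ⟨(hγc.sub continuous_const).continuousOn,
        fun t _ h0 => hγa0 t (by rw [h0, mul_zero]), by simp only [h01γ]⟩
    simp only at e
    rw [e, wind_const, zero_add, hγ]
    exact wind_circleLoop_sub_of_norm_lt (by rw [sub_self, norm_zero]; exact hb)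
  -- the sign pattern of `g`
  have him_g : ∀ t : ℝ, (g t).im = b * Real.cos (2 * π * t) * (K (γ t)).im := by
    intro t; simp only [hg, add_im, one_im, im_ofReal_mul, zero_add]
  have hre_g : ∀ t : ℝ, (g t).re = 1 + b * Real.cos (2 * π * t) * (K (γ t)).re := by
    intro t; simp only [hg, add_re, one_re, re_ofReal_mul]
  have hKm : ∀ z : ℂ, K z = (((1 / (m : ℝ) : ℝ)) : ℂ) * (deriv h z / h z) := by
    intro z; simp only [hK]; push_cast; ring
  have hKim : ∀ z : ℂ, (K z).im = (1 / (m : ℝ)) * (deriv h z / h z).im := by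
    intro z; rw [hKm z, im_ofReal_mul]
  have hKsign : ∀ t : ℝ, Real.sin (2 * π * t) * (K (γ t)).im ≤ 0 := by
    intro t
    have h1 := hsign (γ t) (hγnorm t)
    rw [hγim t] at h1
    rw [hKim]
    have hm1 : 0 < 1 / (m : ℝ) := by positivity
    by_contra hp
    push Not at hp
    have h2 : 0 < Real.sin (2 * π * t) * (deriv h (γ t) / h (γ t)).im := by
      have := hp; nlinarith [this, hm1]
    have := mul_pos hb h2
    nlinarith [this, h1]
  have hKup : ∀ t : ℝ, 0 < t → t < 1 / 2 → (K (γ t)).im ≤ 0 := by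
    intro t h0 h1
    have hs : 0 < Real.sin (2 * π * t) :=
      Real.sin_pos_of_pos_of_lt_pi (by positivity) (by nlinarith [Real.pi_pos])
    have := hKsign t
    by_contra hp; push Not at hp
    have := mul_pos hs hp; linarith
  have hKlow : ∀ t : ℝ, 1 / 2 < t → t < 1 → 0 ≤ (K (γ t)).im := by
    intro t h0 h1
    have hs : Real.sin (2 * π * t) < 0 := by
      rw [← Real.sin_sub_two_pi]
      exact Real.sin_neg_of_neg_of_neg_pi_lt (by nlinarith [Real.pi_pos]) (by nlinarith [Real.pi_pos])
    have := hKsign t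
    by_contra hp; push Not at hp
    have := mul_pos_of_neg_of_neg hs hp; linarith
  have hKreal' : ∀ t : ℝ, (∃ x : ℝ, γ t = (x : ℂ)) → (K (γ t)).im = 0 := by
    rintro t ⟨x, hx⟩
    have hn := hγnorm t
    rw [hx] at hn ⊢
    rw [hKim, hKreal x hn, mul_zero]
  have hK0 : (K (γ 0)).im = 0 := hKreal' 0 ⟨a + b, hγ0⟩
  have hKhalf : (K (γ (1 / 2))).im = 0 := hKreal' (1 / 2) ⟨a - b, hγhalf⟩
  have hK1 : (K (γ 1)).im = 0 := by rw [← h01γ]; exact hK0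
  have hq1 : ∀ t ∈ Icc (0:ℝ) (1/4), (g t).im ≤ 0 := by
    intro t ht
    rw [him_g]
    rcases eq_or_lt_of_le ht.1 with h | h
    · rw [← h, hK0, mul_zero]
    · have hc : 0 ≤ Real.cos (2 * π * t) :=
        Real.cos_nonneg_of_neg_pi_div_two_le_of_le (by nlinarith [Real.pi_pos, ht.1]) (by nlinarith [Real.pi_pos, ht.2])
      exact mul_nonpos_iff.2 (Or.inl ⟨mul_nonneg hb.le hc, hKup t h (by linarith [ht.2])⟩)
  have hq2 : ∀ t ∈ Icc (1/4:ℝ) (1/2), 0 ≤ (g t).im := by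
    intro t ht
    rw [him_g]
    rcases eq_or_lt_of_le ht.2 with h | h
    · rw [h, hKhalf, mul_zero]
    · have hc : Real.cos (2 * π * t) ≤ 0 :=
        Real.cos_nonpos_of_pi_div_two_le_of_le (by nlinarith [Real.pi_pos, ht.1]) (by nlinarith [Real.pi_pos, ht.2])
      exact mul_nonneg_iff.2 (Or.inr ⟨mul_nonpos_iff.2 (Or.inl ⟨hb.le, hc⟩), hKup t (by linarith [ht.1]) h⟩)
  have hq3 : ∀ t ∈ Icc (1/2:ℝ) (3/4), (g t).im ≤ 0 := by
    intro t ht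
    rw [him_g]
    rcases eq_or_lt_of_le ht.1 with h | h
    · rw [← h, hKhalf, mul_zero]
    · have hc : Real.cos (2 * π * t) ≤ 0 :=
        Real.cos_nonpos_of_pi_div_two_le_of_le (by nlinarith [Real.pi_pos, ht.1]) (by nlinarith [Real.pi_pos, ht.2])
      exact mul_nonpos_iff.2 (Or.inr ⟨mul_nonpos_iff.2 (Or.inl ⟨hb.le, hc⟩), hKlow t h (by linarith [ht.2])⟩)
  have hq4 : ∀ t ∈ Icc (3/4:ℝ) 1, 0 ≤ (g t).im := by
    intro t ht
    rw [him_g]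
    rcases eq_or_lt_of_le ht.2 with h | h
    · rw [h, hK1, mul_zero]
    · have hc : 0 ≤ Real.cos (2 * π * t) := by
        rw [← Real.cos_sub_two_pi]
        exact Real.cos_nonneg_of_neg_pi_div_two_le_of_le (by nlinarith [Real.pi_pos, ht.1]) (by nlinarith [Real.pi_pos, ht.2])
      exact mul_nonneg (mul_nonneg hb.le hc) (hKlow t (by linarith [ht.1]) h)
  have hcos1 : Real.cos (2 * π * (1 / 4)) = 0 := by rw [show 2 * π * (1 / 4 : ℝ) = π / 2 by ring]; exact Real.cos_pi_div_two
  have hcos3 : Real.cos (2 * π * (3 / 4)) = 0 := by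
    rw [show 2 * π * (3 / 4 : ℝ) = π / 2 + π by ring, Real.cos_add_pi, Real.cos_pi_div_two, neg_zero]
  have hr0 : (g 0).im = 0 := by rw [him_g, hK0, mul_zero]
  have hr2 : (g (1 / 2)).im = 0 := by rw [him_g, hKhalf, mul_zero]
  have hr1 : (g (1 / 4)).im = 0 := by rw [him_g, hcos1, mul_zero, zero_mul]
  have hr3 : (g (3 / 4)).im = 0 := by rw [him_g, hcos3, mul_zero, zero_mul]
  have hp1 : 0 < (g (1 / 4)).re := by rw [hre_g, hcos1, mul_zero, zero_mul, add_zero]; exact one_pos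
  have hp3 : 0 < (g (3 / 4)).re := by rw [hre_g, hcos3, mul_zero, zero_mul, add_zero]; exact one_pos
  have Wg := wind_eq_of_quadrants hgc g01 (fun t _ => hg0 t) hq1 hq2 hq3 hq4 hr0 hr2 hr1 hp1 hr3 hp3
  have g0re : (g 0).re = 1 + b * (deriv h ((a : ℂ) + b) / ((m : ℂ) * h ((a : ℂ) + b))).re := by
    rw [hre_g, mul_zero, Real.cos_zero, mul_one, hγ0]; push_cast; rfl
  have ghre : (g (1 / 2)).re = 1 - b * (deriv h ((a : ℂ) - b) / ((m : ℂ) * h ((a : ℂ) - b))).re := by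
    rw [hre_g, show 2 * π * (1 / 2 : ℝ) = π by ring, Real.cos_pi, hγhalf]; push_cast; simp only [hK]; ring
  -- assembly
  have Wmh : wind (fun t => (m : ℂ) * h (γ t)) = 0 := by
    have e : wind (fun t => (fun _ : ℝ => (m : ℂ)) t * (fun t => h (γ t)) t) =
        wind (fun _ : ℝ => (m : ℂ)) + wind (fun t => h (γ t)) := wind_mul (IsNonvanishingLoop.const hm0) Lh
    rw [e, wind_const, zero_add, Wh]
  calc ∑ᶠ u, MeromorphicOn.divisor H (closedBall (a : ℂ) b) u
      = wind (fun t => H (γ t)) := by rw [← W0]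
    _ = wind (fun t => (m : ℂ) * h (γ t) * F (γ t)) := congrArg wind (funext hGF)
    _ = wind (fun t => (m : ℂ) * h (γ t)) + wind (fun t => F (γ t)) := wind_mul Lmh LF
    _ = wind (fun t => F (γ t)) := by rw [Wmh, zero_add]
    _ = wind (fun t => 2 * (γ t - a) * g t) := congrArg wind (funext hFg)
    _ = wind (fun t => 2 * (γ t - a)) + wind g := wind_mul L2 Lg
    _ = 1 + wind g := by rw [W2]
    _ = _ := by rw [Wg, g0re, ghre]; ring


end RhW08.ChildCount
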